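/-
Copyright (c) 2026. All rights reserved.
Released under Apache 2.0 license as described in the file LICENSE.
Authors: abc-iut cell, IUT REPAIR / RESCUE-H prover seat abc-iut-rp-d4 (gen 3).
-/
import Literature.IUT.LogVolume.UnitLogWildDepth
import HarnessLib

/-!
# The VALUATION PROFILE of `log_p(𝒪_K^×)` when `(p − 1) ∤ e`, I: the exact norms `‖ϖ‖^{ν(s)}` attained by the
# log-units and the GAPS between them (spheres `{‖z‖ = ‖ϖ‖ᵗ}` that MISS `log_p(𝒪_K^×)`)

PROOF-ONLY file (no `def`, no named fact) of the abc-iut cell (D-0079 RESCUE-H «local-height condition I06⋆»,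
R-H lead's RE-ARM row «rp-d4 → REAL column of I06⋆ per stratum: κ^idx / SHAPE-OPEN cells (valuation profile of
`log 𝒪^×_{K_w}` at deep `w`) → deciding decls»).  Classical `p`-adic analysis (Neukirch ANT II (5.5);
Fesenko–Vostokov I §5–6) assembled on the cell's dominant-term toolkit (`LogSeriesDominantTerm.lean`,
abc-iut-w5-d017) and on `UnitLogWildDepth.norm_le_zpow_of_mem_logUnits` (abc-iut-f-167).  Setting: `K` a proper ultrametric normed
`ℚ_p`-algebra (a finite extension of `ℚ_p`), `e = absRamificationIdx p K`, `ϖ` a norm uniformizer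
(`‖ϖ‖^e = p⁻¹`), `L := log_p(𝒪_K^×)` = `logUnits K`, `ℐ_K := (p*)⁻¹ · L` the log-shell of [AbsTopIII] Def. 5.4 (iii)
(`logShell (PadicLogOnUnits.ofUnitLog p K)`, `logShell_ofUnitLog`).

THE POINT (neutral).  [IUTchIV] Prop. 1.2 (i) brackets `L` between two BALLS, `p^{a_e}𝒪 ⊆ L ⊆ p^{−b_e}𝒪`; between
the two radii it does not decide membership.  But `L` is NOT a ball when `e ≥ p` (`UnitLogDeepRamification`), and
for an element known ONLY BY ITS NORM (e.g. abc-iut's CHOSEN realising q-idele, `Cor312ProvKChosenQIdeleNorm`) the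
honest question is sphere-by-sphere: does `S_t := {‖z‖ = ‖ϖ‖ᵗ}` lie IN `L`, MEET `L` properly, or MISS `L`?
When `(p − 1) ∤ e` (then no «tie» `e = s·pᵃ·(p−1)` is possible, and `K` has no primitive `p`-th root of unity)
the answer is COMPLETE and elementary:

* §1 `norm_logSeries_eq_zpow_of_strictTurning` — for a principal unit `y` with `‖1 − y‖ = ‖ϖ‖ˢ` and a STRICT
  turning point `a₀` (`s·pᵃ·(p−1) < e` for `a < a₀`, `e < s·p^{a₀}·(p−1)`): **`‖L(y)‖ = ‖ϖ‖^{ν}`,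
  `ν = s·p^{a₀} − e·a₀`** (the term of index `p^{a₀}` dominates; abc-iut-w5-d017's argument, isolated).
* §2 arithmetic of the turning data: no tie under `(p−1) ∤ e` (`natCast_ne_turning_of_not_dvd`), existence
  (`exists_strictTurning`), `ν ≤ s − a₀` (`turningValue_add_le`), monotonicity in `s` of `h_s(a) = s·pᵃ − e·a`.
* §3 **every non-zero log-unit has norm `‖ϖ‖^{ν(s)}` for some `s ≥ 1`** (`exists_norm_unitLog_eq_zpow`), and
  **every `ν(s)` is attained** by `log_p(1 − ϖˢ)` (`norm_unitLog_one_sub_pow`): the set of norms of `L ∖ {0}` is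
  EXACTLY `{‖ϖ‖^{ν(s)} : s ≥ 1}`, `ν` strictly increasing, `ν(s) = s` iff `e < s·(p−1)`.
* §4 **MISS** (decided-NEGATIVE cells): `‖z‖ ≠ ‖ϖ‖ᵗ` for every `z ∈ L` as soon as `t` lies in a GAP
  `ν(s) < t < ν(s+1)` (`norm_ne_zpow_of_mem_logUnits_of_gap`; the hypotheses are integer inequalities a table
  writer checks by hand) or below the minimum `t < ν(1)` (`norm_ne_zpow_of_mem_logUnits_of_lt_min`, no hypothesis
  on `e`: abc-iut-f-167's bound).
* Sequel `UnitLogValuationProfileShell.lean`: the SHARP inner ball `{‖z‖ ≤ ‖ϖ‖ʳ} ⊆ L ⟺ e < r·(p−1)` (IN), the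
  properly-met spheres at `t = ν(s)`, `a₀ ≥ 1` (SHAPE-OPEN), and the log-shell dictionary `q ∈ qⁿ·ℐ_K ⟺
  p*·q^{1−n} ∈ L` with the three deciding theorems for a norm-specified `q`.

Not treated here: `(p − 1) ∣ e` (boundary tie `s = e/(p−1)`, where the answer depends on `ζ_p ∈ K`:
`UnitLogBoundaryRamification*`, `UnitLogTorsionFreeBallCriterion`), and `p = 2`.  Nothing here is disputed
mathematics; no IUT statement is asserted; `logUnits` / `logShell` are the cell's typings of [IUTchIV] Prop. 1.2's
`log_p(R^×)` and [AbsTopIII] Def. 5.4 (iii)'s `ℐ_k` ([claim: Mochizuki2012, status: disputed] for those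
locutions only).  No side is taken on [IUTchIII] Cor. 3.12 or on any author.

References: [cite: NeukirchANT1999, Ch. II Prop. (5.5), (5.7)] [cite: Koblitz1984, Ch. IV §1–2]
[cite: MochizukiAbsTopIII2015, Def 5.4 (iii) p. 126].
-/

noncomputable section

open Metric Set

namespace Literature.IUT.LogVolume

namespace ValuationProfile

open Literature.NumberTheory.GaloisRepresentations.Ultrametric RamificationCriterion

/-! ### §1. Exact norm of `L(y)` under a STRICT turning point (every `p`, every `e`) -/

section Exact

variable (p : ℕ) [hp : Fact p.Prime]
variable {K : Type*} [NontriviallyNormedField K] [instK : NormedAlgebra ℚ_[p] K] [IsUltrametricDist K]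
  [ProperSpace K]

/-- **Exact norm under a strict turning point.**  If `y` is a principal unit with `‖1 − y‖ = ‖ϖ‖ˢ` and `a₀`
satisfies `s·pᵃ·(p−1) < e` for `a < a₀` and `e < s·p^{a₀}·(p−1)` (STRICT: no tie), then
`‖L(y)‖ = ‖ϖ‖^{s·p^{a₀} − e·a₀}`: the term of index `p^{a₀}` of the logarithmic series dominates strictly
(`exponent_min_strict`, `exists_exponent_le_index`, `norm_logSeries_eq_zpow_of_dominant` of abc-iut-w5-d017's
toolkit).  [cite: NeukirchANT1999, Ch. II Prop. (5.5)] -/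
theorem norm_logSeries_eq_zpow_of_strictTurning {ϖ : Kˣ} (hϖ : IsUniformizer ϖ) {y : K}
    (hyP : IsPrincipal y) {s : ℤ} (hy : ‖1 - y‖ = ‖(ϖ : K)‖ ^ s) {a₀ : ℕ}
    (hlo : ∀ a < a₀, s * (p : ℤ) ^ a * ((p : ℤ) - 1) < absRamificationIdx p K)
    (hhi : (absRamificationIdx p K : ℤ) < s * (p : ℤ) ^ a₀ * ((p : ℤ) - 1)) :
    ‖logSeries y‖ = ‖(ϖ : K)‖ ^ (s * (p : ℤ) ^ a₀ - (absRamificationIdx p K : ℤ) * (a₀ : ℤ)) := by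
  classical
  have hρ0 : 0 < ‖(ϖ : K)‖ := norm_units_pos ϖ
  have hs1 : 1 ≤ s := by
    have h1 : ‖(ϖ : K)‖ ^ s < 1 := hy ▸ hyP
    have := (zpow_lt_one_iff_right_of_lt_one₀ hρ0 hϖ.1).mp h1
    omega
  set e : ℕ := absRamificationIdx p K with he_def
  have hP : (2 : ℤ) ≤ (p : ℤ) := by exact_mod_cast hp.out.two_le
  have hstrict : ∀ a : ℕ, a ≠ a₀ →
      s * (p : ℤ) ^ a₀ - e * (a₀ : ℤ) + 1 ≤ s * (p : ℤ) ^ a - e * (a : ℤ) :=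
    fun a ha ↦ exponent_min_strict (a₀ := a₀) hs1 hP hlo hhi ha
  obtain ⟨n₀, hn₀1⟩ : ∃ n₀ : ℕ, n₀ + 1 = p ^ a₀ :=
    ⟨p ^ a₀ - 1, Nat.sub_add_cancel (Nat.one_le_pow _ _ hp.out.pos)⟩
  have hN₀ : s * ((n₀ + 1 : ℕ) : ℤ) - (e : ℤ) * (padicValNat p (n₀ + 1) : ℤ)
      = s * (p : ℤ) ^ a₀ - e * (a₀ : ℤ) := by
    rw [hn₀1, padicValNat.prime_pow]
    push_cast
    ring
  have hdom : ∀ n : ℕ, n ≠ n₀ → s * (p : ℤ) ^ a₀ - e * (a₀ : ℤ) + 1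
      ≤ s * ((n + 1 : ℕ) : ℤ) - (e : ℤ) * (padicValNat p (n + 1) : ℤ) := by
    intro n hn
    obtain ⟨a, ha, ha'⟩ := exists_exponent_le_index (p := p) hs1 e (Nat.succ_ne_zero n)
    by_cases haa : a = a₀
    · have hne : n + 1 ≠ p ^ a := by
        rw [haa, ← hn₀1]; intro h; exact hn (by omega)
      have := ha' hne
      rw [haa] at this
      exact this
    · exact (hstrict a haa).trans ha
  exact norm_logSeries_eq_zpow_of_dominant p hϖ hyP hy n₀ hN₀ hdom

end Exact

/-! ### §2. Arithmetic of the turning data -/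

section Arith

variable (p : ℕ)

/-- **No tie under `(p − 1) ∤ e`**: `e ≠ s·pᵃ·(p−1)` for all `s`, `a` (the right side is a multiple of `p − 1`).
[cite: NeukirchANT1999, Ch. II Prop. (5.5)] -/
theorem natCast_ne_turning_of_not_dvd [hp : Fact p.Prime] {e : ℕ} (hnd : ¬ (p - 1) ∣ e) (s : ℤ) (a : ℕ) :
    (e : ℤ) ≠ s * (p : ℤ) ^ a * ((p : ℤ) - 1) := by
  intro h
  apply hnd
  have hcast : ((p - 1 : ℕ) : ℤ) = (p : ℤ) - 1 := by
    rw [Nat.cast_sub hp.out.one_le, Nat.cast_one]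
  have h1 : ((p - 1 : ℕ) : ℤ) ∣ (e : ℤ) := by
    rw [h, hcast]
    exact Dvd.intro_left _ rfl
  exact Int.natCast_dvd_natCast.mp h1

/-- **Existence of a STRICT turning point** for every `s ≥ 1` when `(p − 1) ∤ e`. [cite: NeukirchANT1999, Ch. II Prop. (5.5)] -/
theorem exists_strictTurning [hp : Fact p.Prime] {e : ℕ} (hnd : ¬ (p - 1) ∣ e) {s : ℤ} (hs : 1 ≤ s) :
    ∃ a₀ : ℕ, (∀ a < a₀, s * (p : ℤ) ^ a * ((p : ℤ) - 1) < e) ∧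
      (e : ℤ) < s * (p : ℤ) ^ a₀ * ((p : ℤ) - 1) := by
  classical
  have hP : (2 : ℤ) ≤ (p : ℤ) := by exact_mod_cast hp.out.two_le
  have hex := exists_le_increment hs hP e
  exact ⟨Nat.find hex, fun a ha ↦ lt_of_not_ge (Nat.find_min hex ha),
    lt_of_le_of_ne (Nat.find_spec hex) (natCast_ne_turning_of_not_dvd p hnd s _)⟩

/-- **Uniqueness of the turning point**: the (non-strict) turning data determine `a₀`.
[cite: NeukirchANT1999, Ch. II Prop. (5.5)] -/
theorem turning_unique {s E : ℤ} (hs : 1 ≤ s) {a₀ a₁ : ℕ}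
    (hlo₀ : ∀ a < a₀, s * (p : ℤ) ^ a * ((p : ℤ) - 1) < E) (hhi₀ : E ≤ s * (p : ℤ) ^ a₀ * ((p : ℤ) - 1))
    (hlo₁ : ∀ a < a₁, s * (p : ℤ) ^ a * ((p : ℤ) - 1) < E) (hhi₁ : E ≤ s * (p : ℤ) ^ a₁ * ((p : ℤ) - 1)) :
    a₀ = a₁ := by
  have _ := hs
  by_contra hne
  rcases lt_or_gt_of_ne hne with h | h
  · exact absurd hhi₀ (not_le.mpr (hlo₁ a₀ h))
  · exact absurd hhi₁ (not_le.mpr (hlo₀ a₁ h))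

/-- **`ν ≤ s − a₀`**: below the turning point the exponents strictly decrease from `h(0) = s`
(`exponent_add_le`); in particular `ν(s) < s` as soon as `a₀ ≥ 1`, i.e. as soon as `s·(p−1) < e`.
[cite: NeukirchANT1999, Ch. II Prop. (5.5)] -/
theorem turningValue_add_le {s E : ℤ} {a₀ : ℕ} (hlo : ∀ a < a₀, s * (p : ℤ) ^ a * ((p : ℤ) - 1) < E) :
    s * (p : ℤ) ^ a₀ - E * (a₀ : ℤ) + a₀ ≤ s := by
  have h := exponent_add_le hlo a₀ 0 (by omega)
  simpa using h

/-- Monotonicity of `h_s(a) = s·pᵃ − E·a` in `s`. [cite: NeukirchANT1999, Ch. II Prop. (5.5)] -/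
theorem exponent_mono_left {s s' : ℤ} (h : s ≤ s') (a : ℕ) (E : ℤ) :
    s * (p : ℤ) ^ a - E * (a : ℤ) ≤ s' * (p : ℤ) ^ a - E * (a : ℤ) := by
  have : (0 : ℤ) ≤ (p : ℤ) ^ a := by positivity
  nlinarith

/-- **`ν` is strictly increasing**: `ν(s) = min_a h_s(a) ≤ h_s(a₁) < h_{s+1}(a₁) = ν(s+1)` for the turning point
`a₁` of `s + 1` (only the non-strict turning data of `s` are used). [cite: NeukirchANT1999, Ch. II Prop. (5.5)] -/
theorem turningValue_lt_succ [hp : Fact p.Prime] {s E : ℤ} (hs : 1 ≤ s) {a₀ : ℕ} (a₁ : ℕ)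
    (hlo₀ : ∀ a < a₀, s * (p : ℤ) ^ a * ((p : ℤ) - 1) < E) (hhi₀ : E ≤ s * (p : ℤ) ^ a₀ * ((p : ℤ) - 1)) :
    s * (p : ℤ) ^ a₀ - E * (a₀ : ℤ) < (s + 1) * (p : ℤ) ^ a₁ - E * (a₁ : ℤ) := by
  have hP : (2 : ℤ) ≤ (p : ℤ) := by exact_mod_cast hp.out.two_le
  have hmin := exponent_min (a₀ := a₀) hs hP hlo₀ hhi₀ a₁
  have hpos : (0 : ℤ) < (p : ℤ) ^ a₁ := by positivity
  linarith

end Arith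

/-! ### §3. The norms attained by `log_p(𝒪_K^×)` when `(p − 1) ∤ e` -/

section Units

variable (p : ℕ) [hp : Fact p.Prime]
variable {K : Type*} [NontriviallyNormedField K] [instK : NormedAlgebra ℚ_[p] K] [IsUltrametricDist K]
  [ProperSpace K]

/-- **Every non-zero log-unit has norm `‖ϖ‖^{ν(s)}` for some `s ≥ 1`** (`(p − 1) ∤ e`): for a unit `u`,
`log_p u = m⁻¹·L(uᵐ)` with `uᵐ` principal, `p ∤ m` (`‖m⁻¹‖ = 1`), `‖1 − uᵐ‖ = ‖ϖ‖ˢ`, and §1 applies with the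
strict turning point of `s`. [cite: NeukirchANT1999, Ch. II Prop. (5.5)] -/
theorem exists_norm_unitLog_eq_zpow (hnd : ¬ (p - 1) ∣ absRamificationIdx p K) {ϖ : Kˣ} (hϖ : IsUniformizer ϖ)
    {u : K} (hu : ‖u‖ = 1) (h0 : unitLog u ≠ 0) :
    ∃ s : ℤ, 1 ≤ s ∧ ∃ a₀ : ℕ, (∀ a < a₀, s * (p : ℤ) ^ a * ((p : ℤ) - 1) < absRamificationIdx p K) ∧
      (absRamificationIdx p K : ℤ) < s * (p : ℤ) ^ a₀ * ((p : ℤ) - 1) ∧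
      ‖unitLog u‖ = ‖(ϖ : K)‖ ^ (s * (p : ℤ) ^ a₀ - (absRamificationIdx p K : ℤ) * (a₀ : ℤ)) := by
  classical
  have hρ0 : 0 < ‖(ϖ : K)‖ := norm_units_pos ϖ
  obtain ⟨m, hm0, hmp, hmP⟩ := exists_pow_isPrincipal_not_dvd (p := p) hu
  have hlog : unitLog u = ((m : ℕ) : K)⁻¹ * logSeries (u ^ m) := unitLog_eq_inv_mul_logSeries p hm0 hmP
  have hx : 1 - u ^ m ≠ 0 := by
    intro hx
    apply h0
    rw [hlog, ← sub_eq_zero.mp hx, logSeries_one, mul_zero]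
  obtain ⟨s, hs⟩ := hϖ.2 (Units.mk0 (1 - u ^ m) hx)
  rw [Units.val_mk0] at hs
  have hs1 : 1 ≤ s := by
    have h1 : ‖(ϖ : K)‖ ^ s < 1 := hs ▸ hmP
    have := (zpow_lt_one_iff_right_of_lt_one₀ hρ0 hϖ.1).mp h1
    omega
  obtain ⟨a₀, hlo, hhi⟩ := exists_strictTurning p hnd hs1
  refine ⟨s, hs1, a₀, hlo, hhi, ?_⟩
  rw [hlog, norm_mul, norm_inv, norm_natCast_eq_one_of_not_dvd p hmp, inv_one, one_mul]
  exact norm_logSeries_eq_zpow_of_strictTurning p hϖ hmP hs hlo hhi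

/-- **Every `ν(s)` is attained**: `‖log_p(1 − ϖˢ)‖ = ‖ϖ‖^{s·p^{a₀} − e·a₀}` for `s ≥ 1` and its strict turning point `a₀`
(every `p`, `e`). [cite: NeukirchANT1999, Ch. II Prop. (5.5)] -/
theorem norm_unitLog_one_sub_pow {ϖ : Kˣ} (hϖ : IsUniformizer ϖ) {s : ℕ} (hs : 1 ≤ s) {a₀ : ℕ}
    (hlo : ∀ a < a₀, (s : ℤ) * (p : ℤ) ^ a * ((p : ℤ) - 1) < absRamificationIdx p K)
    (hhi : (absRamificationIdx p K : ℤ) < (s : ℤ) * (p : ℤ) ^ a₀ * ((p : ℤ) - 1)) :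
    ‖unitLog (1 - (ϖ : K) ^ s)‖ =
      ‖(ϖ : K)‖ ^ ((s : ℤ) * (p : ℤ) ^ a₀ - (absRamificationIdx p K : ℤ) * (a₀ : ℤ)) := by
  have hy : ‖1 - (1 - (ϖ : K) ^ s)‖ = ‖(ϖ : K)‖ ^ (s : ℤ) := by
    rw [sub_sub_cancel, norm_pow, zpow_natCast]
  have hyP : IsPrincipal (1 - (ϖ : K) ^ s) := by
    rw [isPrincipal_iff, hy, zpow_natCast]
    exact pow_lt_one₀ (norm_nonneg _) hϖ.1 (by omega)
  rw [unitLog_of_isPrincipal p hyP]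
  exact norm_logSeries_eq_zpow_of_strictTurning p hϖ hyP hy hlo hhi

/-- `1 − ϖˢ` is a unit and its logarithm is a log-unit of norm `‖ϖ‖^{ν(s)}` (witness form of the preceding).
[cite: NeukirchANT1999, Ch. II Prop. (5.5)] -/
theorem exists_mem_logUnits_norm_eq_zpow {ϖ : Kˣ} (hϖ : IsUniformizer ϖ) {s : ℕ} (hs : 1 ≤ s) {a₀ : ℕ}
    (hlo : ∀ a < a₀, (s : ℤ) * (p : ℤ) ^ a * ((p : ℤ) - 1) < absRamificationIdx p K)
    (hhi : (absRamificationIdx p K : ℤ) < (s : ℤ) * (p : ℤ) ^ a₀ * ((p : ℤ) - 1)) :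
    ∃ z ∈ logUnits K, ‖z‖ = ‖(ϖ : K)‖ ^ ((s : ℤ) * (p : ℤ) ^ a₀ - (absRamificationIdx p K : ℤ) * (a₀ : ℤ)) := by
  have hu : ‖1 - (ϖ : K) ^ s‖ = 1 := by
    have hyP : IsPrincipal (1 - (ϖ : K) ^ s) := by
      rw [isPrincipal_iff, sub_sub_cancel, norm_pow]
      exact pow_lt_one₀ (norm_nonneg _) hϖ.1 (by omega)
    exact hyP.norm_eq_one
  exact ⟨unitLog (1 - (ϖ : K) ^ s), unitLog_mem_logUnits hu, norm_unitLog_one_sub_pow p hϖ hs hlo hhi⟩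

/-! ### §4. MISS: the gaps of the profile are decided-NEGATIVE -/

/-- **Below the minimum** (every `e`, abc-iut-f-167's `norm_le_zpow_of_mem_logUnits`): with `a₀` the turning point of
`s = 1`, every log-unit has `‖z‖ ≤ ‖ϖ‖^{p^{a₀} − e·a₀}`; so NO log-unit has norm `‖ϖ‖ᵗ` for `t < p^{a₀} − e·a₀`.
[cite: NeukirchANT1999, Ch. II Prop. (5.5)] -/
theorem norm_ne_zpow_of_mem_logUnits_of_lt_min {ϖ : Kˣ} (hϖ : IsUniformizer ϖ) {a₀ : ℕ}
    (hlo : ∀ a < a₀, (1 : ℤ) * (p : ℤ) ^ a * ((p : ℤ) - 1) < absRamificationIdx p K)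
    (hhi : (absRamificationIdx p K : ℤ) ≤ 1 * (p : ℤ) ^ a₀ * ((p : ℤ) - 1)) {t : ℤ}
    (ht : t < 1 * (p : ℤ) ^ a₀ - (absRamificationIdx p K : ℤ) * (a₀ : ℤ))
    {z : K} (hz : z ∈ logUnits K) : ‖z‖ ≠ ‖(ϖ : K)‖ ^ t := by
  have hρ0 : 0 < ‖(ϖ : K)‖ := norm_units_pos ϖ
  have hle := norm_le_zpow_of_mem_logUnits p hϖ hlo hhi hz
  have hlt : ‖(ϖ : K)‖ ^ (1 * (p : ℤ) ^ a₀ - (absRamificationIdx p K : ℤ) * (a₀ : ℤ)) < ‖(ϖ : K)‖ ^ t :=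
    zpow_lt_zpow_right_of_lt_one₀ hρ0 hϖ.1 ht
  exact ne_of_lt (hle.trans_lt hlt)

/-- **GAP THEOREM** (`(p − 1) ∤ e`).  If `t` lies strictly between `h_s(a₀) = s·p^{a₀} − e·a₀` (ANY `a₀`; for the
turning point of `s` this is `ν(s)`) and `ν(s+1) = (s+1)·p^{a₁} − e·a₁` (`a₁` the turning point of `s + 1`), then NO
log-unit has norm `‖ϖ‖ᵗ`: a log-unit of norm `‖ϖ‖^{ν(s')}` has `ν(s') ≤ h_{s'}(a₀) ≤ h_s(a₀) < t` if `s' ≤ s` and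
`ν(s') = h_{s'}(a') ≥ h_{s+1}(a') ≥ ν(s+1) > t` if `s' ≥ s + 1`.  The decided-NEGATIVE cells of the RESCUE-H table.
[cite: NeukirchANT1999, Ch. II Prop. (5.5)] -/
theorem norm_ne_zpow_of_mem_logUnits_of_gap (hnd : ¬ (p - 1) ∣ absRamificationIdx p K) {ϖ : Kˣ}
    (hϖ : IsUniformizer ϖ) {t s : ℤ} (hs : 1 ≤ s) {a₀ a₁ : ℕ}
    (h1 : s * (p : ℤ) ^ a₀ - (absRamificationIdx p K : ℤ) * (a₀ : ℤ) < t)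
    (hlo₁ : ∀ a < a₁, (s + 1) * (p : ℤ) ^ a * ((p : ℤ) - 1) < absRamificationIdx p K)
    (hhi₁ : (absRamificationIdx p K : ℤ) ≤ (s + 1) * (p : ℤ) ^ a₁ * ((p : ℤ) - 1))
    (h2 : t < (s + 1) * (p : ℤ) ^ a₁ - (absRamificationIdx p K : ℤ) * (a₁ : ℤ))
    {z : K} (hz : z ∈ logUnits K) : ‖z‖ ≠ ‖(ϖ : K)‖ ^ t := by
  intro hzt
  have hρ0 : 0 < ‖(ϖ : K)‖ := norm_units_pos ϖ
  have hP : (2 : ℤ) ≤ (p : ℤ) := by exact_mod_cast hp.out.two_le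
  obtain ⟨u, hu, rfl⟩ := mem_logUnits_iff.mp hz
  have hz0 : unitLog u ≠ 0 := by
    intro h0
    rw [h0, norm_zero] at hzt
    exact (zpow_pos hρ0 t).ne hzt
  obtain ⟨s', hs', a', hlo', hhi', hnorm⟩ := exists_norm_unitLog_eq_zpow p hnd hϖ hu hz0
  have heq : s' * (p : ℤ) ^ a' - (absRamificationIdx p K : ℤ) * (a' : ℤ) = t :=
    zpow_right_injective₀ hρ0 hϖ.1.ne (hnorm.symm.trans hzt)
  rcases le_or_gt s' s with hle | hgt
  · have hmin' := exponent_min (a₀ := a') hs' hP hlo' hhi'.le a₀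
    have hmono := exponent_mono_left p hle a₀ (absRamificationIdx p K : ℤ)
    linarith
  · have hmono := exponent_mono_left p (show s + 1 ≤ s' by omega) a' (absRamificationIdx p K : ℤ)
    have hmin₁ := exponent_min (a₀ := a₁) (show (1 : ℤ) ≤ s + 1 by omega) hP hlo₁ hhi₁ a'
    linarith

/-- **The integer `⌊e/(p−1)⌋` is a MISS** (`(p − 1) ∤ e`): writing `r₁·(p−1) < e < (r₁+1)·(p−1)`, no log-unit has norm
`‖ϖ‖^{r₁}` — the top gap `(ν(r₁), r₁ + 1)` of the profile contains `r₁` (and `r₁ + 1 = ν(r₁+1)` is the first full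
sphere, §5). [cite: NeukirchANT1999, Ch. II Prop. (5.5)] -/
theorem norm_ne_zpow_floor_of_mem_logUnits (hnd : ¬ (p - 1) ∣ absRamificationIdx p K) {ϖ : Kˣ}
    (hϖ : IsUniformizer ϖ) {r₁ : ℤ} (hr : r₁ * ((p : ℤ) - 1) < absRamificationIdx p K)
    (hr' : (absRamificationIdx p K : ℤ) < (r₁ + 1) * ((p : ℤ) - 1))
    {z : K} (hz : z ∈ logUnits K) : ‖z‖ ≠ ‖(ϖ : K)‖ ^ r₁ := by
  have hP : (2 : ℤ) ≤ (p : ℤ) := by exact_mod_cast hp.out.two_le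
  rcases le_or_gt 1 r₁ with hr1 | hr0
  · -- the gap between `h_{r₁}(1) = r₁·p − e < r₁` and `ν(r₁ + 1) = r₁ + 1` (turning point `0`)
    refine norm_ne_zpow_of_mem_logUnits_of_gap p hnd hϖ hr1 (a₀ := 1) (a₁ := 0) ?_ (fun a ha ↦ ?_) ?_ ?_ hz
    · rw [pow_one]; push_cast; linarith
    · omega
    · simpa using hr'.le
    · simp
  · -- `r₁ ≤ 0`: then `e < p − 1`, the minimum of the profile is `ν(1) = 1 > r₁`
    refine norm_ne_zpow_of_mem_logUnits_of_lt_min p hϖ (a₀ := 0) (fun a ha ↦ ?_) ?_ ?_ hz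
    · omega
    · have : (r₁ + 1) * ((p : ℤ) - 1) ≤ 1 * ((p : ℤ) - 1) := by nlinarith
      simpa using (hr'.le.trans this)
    · simp; omega

end Units

end ValuationProfile

end Literature.IUT.LogVolume

end
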